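import Summits.ResolutionOfSingularities.ResolutionOfSingularities.Theorems.FrobeniusLadderFRationalResolutionGradedDegreeZeroFinite
import Summits.ResolutionOfSingularities.ResolutionOfSingularities.Theorems.FrobeniusLadderFRationalResolutionTraceIdealCharacteristic
import Summits.ResolutionOfSingularities.ResolutionOfSingularities.Theorems.FrobeniusLadderFRationalResolutionDivisorialIdealsCharacteristic
import Literature.RingTheory.MvPowerSeries.MonoidPowerSeriesPure
import Literature.RingTheory.MvPowerSeries.MonoidPowerSeriesGenerators
import Literature.AlgebraicGeometry.Resolution.RegularLocalRingsNormal
import HarnessLib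

/-!
# Crux `FrobeniusLadder.FRationalResolution` (stmt-ResolutionOfSingularities-15317), line `redirect`,
# stub `stub_diagonalizableQuotientResolution` — ★★★ `hfin` FOR THE COMPLETED TORIC RING `κ⟦P⟧`, `P = {m : Σ mᵢwᵢ = 0 in ℤ/r}`, AND ITS TRANSPORT

The tree's model of the complete local ring of a split diagonalizable quotient singularity is the completed monoid algebra
`κ⟦P⟧ = Literature.RingTheory.MvPowerSeries.monoidPowerSeries κ P ⊆ κ⟦y₁,…,yₙ⟧` (Kato 1994 §3; structure theorem (3.2) in
`Literature…LogRegularCompleteStructure`). For the WEIGHT KERNEL `P = {m : Σ m(i)·w(i) = 0}` of weights `w : Fin n → ℤ/r` (`r ≠ 0`; `P` is pure and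
finitely generated):

* ★★★ `finite_traceIdeals_divisorial_monoidPowerSeries` — **the set of trace ideals of the nonzero divisorial ideals of `κ⟦P⟧` is finite**
  (`…GradedDegreeZeroFinite.finite_traceIdeals_divisorial_mvPowerSeries`, p840330; `κ⟦P⟧` is Noetherian and integrally closed by the tree's
  `monoidPowerSeries.isNoetherianRing` / `isIntegrallyClosed_of_pure`);
* ★ `finite_traceIdeals_of_ringEquiv` — the finiteness is transported along ring isomorphisms (p839093 `map_traceIdeal_eq`, p839146
  `divisorial_map_ringEquiv`), so **`hfin` holds for every `Ê ≅ κ⟦P⟧`** — `hfin_of_ringEquiv_monoidPowerSeries`.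

With this the `hfin` input of `…CompletionDomain.hloc_of_traceIdealCentre_then_finite_singularPoints_of_isIntegrallyClosed` (p840173) is reduced to the
ring isomorphism `Ê ≅ κ'⟦P⟧` (Kato (3.2) at a split twisted point). Honest label: assembly toward ONE leaf stub (no stub, crux or summit closed).
No definitions, no named facts, no sorry. [cite: Kato1994, §3; Thm. (3.2)] [cite: BrunsGubeladze2009, Thm. 4.38] [folklore; cite: BrunsHerzog1993, §1.5]
-/

noncomputable section

-- single-problem summit: the doubled namespace component is forced
set_option linter.dupNamespace false

open Literature.RingTheory.MvPowerSeries Literature.AlgebraicGeometry.Resolution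
open Summit.ResolutionOfSingularities.ResolutionOfSingularities.Theorems.FRationalResolution

namespace Summit.ResolutionOfSingularities.ResolutionOfSingularities.Theorems.FRationalResolution.TraceIdealsFiniteMonoidPowerSeries

universe u

/-! ## §1 Transport along ring isomorphisms -/

/-- ★ **`𝒯` is transported along ring isomorphisms**: if the set of trace ideals of nonzero divisorial ideals of `R` is finite then so is that of
any `R' ≅ R`. [folklore] -/
theorem finite_traceIdeals_of_ringEquiv {R R' : Type u} [CommRing R] [CommRing R'] (e : R ≃+* R')
    (h : Set.Finite {T : Ideal R | ∃ I : Ideal R,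
      (I ≠ ⊥ ∧ ∀ x : R, (∀ a b : R, (∀ y ∈ I, b * y ∈ Ideal.span ({a} : Set R)) → b * x ∈ Ideal.span ({a} : Set R)) → x ∈ I) ∧
      T = ⨆ φ : I →ₗ[R] R, LinearMap.range φ}) :
    Set.Finite {T : Ideal R' | ∃ I : Ideal R',
      (I ≠ ⊥ ∧ ∀ x : R', (∀ a b : R', (∀ y ∈ I, b * y ∈ Ideal.span ({a} : Set R')) → b * x ∈ Ideal.span ({a} : Set R')) → x ∈ I) ∧
      T = ⨆ φ : I →ₗ[R'] R', LinearMap.range φ} := by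
  refine (h.image (Ideal.map e)).subset ?_
  rintro T ⟨I', hI', rfl⟩
  refine ⟨⨆ φ : ↥(I'.map e.symm) →ₗ[R] R, LinearMap.range φ, ⟨I'.map e.symm,
    DivisorialIdealsCharacteristic.divisorial_map_ringEquiv e.symm I' hI', rfl⟩, ?_⟩
  rw [TraceIdealCharacteristic.map_traceIdeal_eq e (I'.map e.symm)]
  -- rewrite the index type `↥((I'.map e.symm).map e)` to `↥I'`
  have hI : (I'.map e.symm).map e = I' := TraceIdealCharacteristic.map_symm_map e I'
  revert hI
  generalize (I'.map e.symm).map e = J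
  rintro rfl
  rfl

/-! ## §2 The completed toric ring of a weight kernel -/

/-- ★★★ **Finitely many trace ideals of divisorial ideals in `κ⟦P⟧`, `P` the weight kernel.** [cite: Kato1994, §3] [folklore; cite: BrunsHerzog1993, §1.5] -/
theorem finite_traceIdeals_divisorial_monoidPowerSeries (κ : Type u) [Field κ] (n r : ℕ) [NeZero r] (w : Fin n → ZMod r)
    (P : AddSubmonoid (Fin n →₀ ℕ)) (hP : ∀ m : Fin n →₀ ℕ, m ∈ P ↔ Finsupp.weight w m = 0) (hPfg : P.FG) :
    Set.Finite {T : Ideal ↥(monoidPowerSeries κ P) | ∃ I : Ideal ↥(monoidPowerSeries κ P),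
      (I ≠ ⊥ ∧ ∀ x, (∀ a b, (∀ y ∈ I, b * y ∈ Ideal.span ({a} : Set ↥(monoidPowerSeries κ P))) →
        b * x ∈ Ideal.span ({a} : Set ↥(monoidPowerSeries κ P))) → x ∈ I) ∧
      T = ⨆ φ : I →ₗ[↥(monoidPowerSeries κ P)] ↥(monoidPowerSeries κ P), LinearMap.range φ} := by
  classical
  haveI : IsRegularLocalRing (MvPowerSeries (Fin n) κ) := (isRegularLocalRing_mvPowerSeries_fin κ n).1
  haveI : IsDomain (MvPowerSeries (Fin n) κ) := isDomain_of_isRegularLocalRing _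
  haveI : IsIntegrallyClosed (MvPowerSeries (Fin n) κ) := isIntegrallyClosed_of_isRegularLocalRing _
  have hpure : ∀ a ∈ P, ∀ b : Fin n →₀ ℕ, a + b ∈ P → b ∈ P := by
    intro a ha b hab
    rw [hP] at ha hab ⊢
    rw [map_add, ha, zero_add] at hab
    exact hab
  obtain ⟨hdom, hic⟩ := monoidPowerSeries.isIntegrallyClosed_of_pure (R := κ) (P := P) hpure
  haveI := hdom
  haveI := hic
  haveI : IsNoetherianRing ↥(monoidPowerSeries κ P) := monoidPowerSeries.isNoetherianRing hPfg
  refine GradedDegreeZeroFinite.finite_traceIdeals_divisorial_mvPowerSeries κ n r w Subtype.val_injective fun f => ?_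
  constructor
  · rintro ⟨x, rfl⟩ m hm
    by_contra hw
    exact hm (monoidPowerSeries.coeff_eq_zero_of_mem x.2 (e := m) ((hP m).not.mpr hw))
  · intro hf
    refine ⟨⟨f, (monoidPowerSeries.mem_monoidPowerSeries_iff (R := κ) (P := P)).mpr fun m hm => ?_⟩, rfl⟩
    by_contra hc
    exact hm ((hP m).mpr (hf m hc))

/-- ★★★ **`hfin` for every ring isomorphic to `κ⟦P⟧`.** [cite: Kato1994, §3; Thm. (3.2)] [folklore] -/
theorem hfin_of_ringEquiv_monoidPowerSeries {E : Type u} [CommRing E] (κ : Type u) [Field κ] (n r : ℕ) [NeZero r] (w : Fin n → ZMod r)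
    (P : AddSubmonoid (Fin n →₀ ℕ)) (hP : ∀ m : Fin n →₀ ℕ, m ∈ P ↔ Finsupp.weight w m = 0) (hPfg : P.FG)
    (e : ↥(monoidPowerSeries κ P) ≃+* E) :
    Set.Finite {T : Ideal E | ∃ I : Ideal E,
      (I ≠ ⊥ ∧ ∀ x : E, (∀ a b : E, (∀ y ∈ I, b * y ∈ Ideal.span ({a} : Set E)) → b * x ∈ Ideal.span ({a} : Set E)) → x ∈ I) ∧
      T = ⨆ φ : I →ₗ[E] E, LinearMap.range φ} :=
  finite_traceIdeals_of_ringEquiv e (finite_traceIdeals_divisorial_monoidPowerSeries κ n r w P hP hPfg)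

end Summit.ResolutionOfSingularities.ResolutionOfSingularities.Theorems.FRationalResolution.TraceIdealsFiniteMonoidPowerSeries

end
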